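import Summits.HodgeConjecture.HodgeConjecture.Theorems.F0P6aStubEHECKEOrganT
import HarnessLib

/-!
# `F0P6aStubEHECKEOrganMP` — ★ RE-HOME of `Lines/F0_P6a_StubEHECKE.lean`, PART 4 of 6 (size-lint split; cut at a declaration boundary).

## Import provenance
- `Theorems.F0P6aStubEHECKEOrganT` = ★ previous part of the same `Lines` workfile `F0_P6a_StubEHECKE` (size-lint split ×6); `HarnessLib`.

See PART 1 `Theorems/F0P6aStubEHECKESocket.lean` for the full re-home header and the original module docstring (verbatim there). Namespaces and sections KEPT
(re-opened below exactly as they stand at the cut, with their `open`∕`variable` lines replayed); code bytes = the workfile՚s, docstrings included; options preamble repeated from PART 1.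
HC_CM is proved only modulo the 7 printed citations (2 remaining: hLiu418 = stmt-HodgeConjecture-24832, h413 = stmt-HodgeConjecture-24833) until rung 0 closes; a re-home is count-neutral. -/

set_option autoImplicit false

noncomputable section

namespace Summit.HodgeConjecture.HodgeConjecture.Cruxes.HLiu418.F0P6aStubEHECKE
set_option linter.dupNamespace false
open CategoryTheory CategoryTheory.Limits NumberField IsDedekindDomain MulAction AlgebraicGeometry
open scoped Matrix Polynomial Pointwise
open Literature.NumberTheory.GaloisRepresentations
open Literature.NumberTheory.Automorphic Literature.NumberTheory.Automorphic.UnitaryGroup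
open Literature.AlgebraicGeometry.ShimuraVarieties Literature.AlgebraicGeometry.ShimuraVarieties.UnitaryCanonicalModel
open Literature.NumberTheory.Automorphic.Liu2021.AppendixC
open Literature.AlgebraicGeometry.Motives (AlgPoints ComplexPoints SchemeOver thickeningLift specOver)
open Literature.AlgebraicGeometry.Motives.AbelianVariety (bcSpec)
open Literature.AlgebraicGeometry.AbelianSchemes (PolarizedAbelianSchemeWithLevel AbelianSchemeOver)
open Literature.AlgebraicGeometry.ModuliOfAbelianVarieties
open Summit.HodgeConjecture.HodgeConjecture.Cruxes.HLiu418.F0P6aPELWitnessE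
open Summit.HodgeConjecture.HodgeConjecture.Cruxes.HLiu418.F0P6aStubE6 (RingActionReading Reads)
open Summit.HodgeConjecture.HodgeConjecture.Cruxes.HLiu418.F0P6aEReadings (EHeckeAt HeckeRoofsE RoofE schEOf fibreEOf dualEOf polEOf lvlPtEOf actEOf IsIdealTorsionE)
open Literature.AlgebraicGeometry.AbelianSchemes.AbelianSchemeOver (fibreHom RingAction exists_pointsAlong_mulEquiv_of_eq pointsAlong_map_of_eq
  pointsAlong_forall_map_eq_one_iff_of_eq roof_readAt_comp_of_eq)
open Summit.HodgeConjecture.HodgeConjecture.Cruxes.HLiu418.F0P6aModuliDatumDefs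
open Summit.HodgeConjecture.HodgeConjecture.Cruxes.HLiu418.F0P6aRGDAssembly
open Literature.AlgebraicGeometry.Motives (CMType)
open Literature.AlgebraicGeometry.ShimuraVarieties.UnitaryCanonicalModel.Aux (ratBasis torusFinAdelic)
open Literature.AlgebraicGeometry.ShimuraVarieties.UnitaryCurve Literature.AlgebraicGeometry.ShimuraVarieties.UnitaryCurve.AuxV
open Literature.NumberTheory.ComplexMultiplication.CMTypeOps (flip bar)
open Literature.Geometry.Kaehler (ComplexTorus)
open Summit.HodgeConjecture.HodgeConjecture.Cruxes.HLiu418.F0P6aChartFramePin (IsChartOfFrame)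


set_option maxHeartbeats 400000 in
/-- **ORGAN (O-MP) `OrganMP` — THE MARKED PAIR OF A HECKE TRANSLATE.**  Letter context + PIN + `hR : RingActionReading C ε ρ`; a split place `w` with `Kc` hyperspecial at
`v = w|_{F⁺}` and `J⋆_w ∈ GL₂(𝒪_w)`; a level `N′ ≤ Kc`, ANY representative `t` of ANY coset in `Kc t_{w,i} Kc ∕ Kc` (`i = 1`: `rc₁ β`, `i = 2`: `rc₂ β₂`, by `hrcᵢ`) with
`HeckeLE t N′ Kc`, and a complex point `x′` of `X_{N′}`.  Put `y₁ := ℓ x′`, `y₂ := T_t x′` (points of `X_{Kc}`), `xᵢ := sheetPt yᵢ` (their `τE♯`-sheet points of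
`X ⊗_F Fᵢ`; `P.A.fibre xᵢ.left = fibreAt S Kc τE♯ P.A yᵢ` ON THE NOSE).  SHAPE (v4.2): STAGE A depends on `x′` ONLY (one reading of `y₁`, one mover `q₁` — so the assemblers define ALL lines `H_β` in ONE marking `m₁`), STAGE B is per `(w, i, t)`.  THEN there are: the frame class `[v, a′]_{N′}` of `x′` (so `pts y₁ = [v, a′]`, `pts y₂ = [v, a′t]`,
§2b `pts_map_homOfLE` ∕ `pts_map_recordHeckeTranslateGS`); the two READING representatives `[vᵢ, aᵢ]` with their L6 readings AT THE CHART՚S PRINCIPAL REPRESENTATIVE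
`(C.u (piece aᵢ), C.rep (piece aᵢ))` (§2b `reads_sheetPt` + `C.rep_spec`): markings `mᵢ` of `A_{yᵢ}` by `[J(Z aᵢ vᵢ), rep (piece aᵢ)]`, ample `Θᵢ` with `IsLambdaOfAt`, symplectic
lifts `Λᵢ` reading the level tower through `mᵢ.r`, `mᵢ.γ = 1`, `mᵢ.Ψ = Π_{Z aᵢ vᵢ}`, `ρ` read as `C.Mρ aᵢ`; the two CLASS MOVERS `q₁, q₂ ∈ GSp_δ(ℚ)` (★
`exists_mover_of_mk_eq_mk_frame` at `[v₁, a₁] = [v, a′]`, `[v₂, a₂] = [v, a′t]`: `J`-law, lattice∕level law `qᵢ · rep(piece aᵢ) ≡ b(a′)`, `b(a′t)` `(mod K_δ(N))`, reading law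
`Mρ aᵢ = qᵢ⁻¹ ρ₀ qᵢ`); and for the RATIONAL TRANSPORTER `T := q₂⁻¹ q₁` the three laws the assemblers cannot invent: **(T-ν)** `T` is `ψ_δ`-SYMPLECTIC (multiplier `1`:
`|ν(qᵢ)| = ‖ν(b a′)‖ = ‖ν(b(a′t))‖` since `ν(b t) = 1` for unitary `t`, and both `J(Z aᵢ vᵢ)` lie in one component); **(T-Λ)** the `𝔭_w`-family `T · Mρ a₁(π)`, `π ∈ 𝔭_w`,
moves the lattice `Λ(rep (piece a₁))` into `Λ(rep (piece a₂))` (PIN `C.b = ũ_{Fr}(·,1)`, `C.ρ₀` = frame reading + ★ p849751 (L-a) `reading_mulVec_mem_latticeOfGL_heckeNeighbour`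
at the frame lattices `Λ(b a′) → Λ(b(a′t))`, conjugated by the movers); **(T-Λ♭)** conversely `ρ(𝔭_{c•w})·T⁻¹Λ(rep (piece a₂)) ⊆ Λ(rep (piece a₁))` (★ p850267); **(T-Λc)** for the CENTRAL operator (`i = 2`) the equality `𝔭_w⁻¹T⁻¹Λ₂ = 𝔭_{c•w}⁻¹Λ₁` (the `hK₂` half of `HeckeCentralRoofsAt`; (L-d =) frame ★ LA5-p02 (g4) + transport ★ B-p08 (g35), L5-#13); **(T-lvl)** it carries the level vectors of `y₁` to those of `y₂` modulo `Λ(rep (piece a₂))` (`t_ℓ = 1`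
and `qᵢ rep ≡ b(·) (mod K_δ(N))` at `ℓ ∣ N`; `p`-integrality from (T-Λ)).  CONSUMERS: (O-HF) (LA6-p02) at `M₁ := C.Mρ a₁`, `M₂ := C.Mρ a₂`, `T`, `hTM` from the reading
laws, `hΛ` = (T-Λ); (O-R1)∕(O-R2) assemblers: `hlvl` from (T-lvl) + the tower readings at `M = N`, `hsim` via A-p06՚s (ρ-SIM) with `ν(T) = 1` = (T-ν) — the ROOTS `Λᵢ.ζ`
of the two symplectic lifts are DATA of the lifts (★ `SymplecticLift.ζ`), not readable from `Reads`: (ρ-SIM) must absorb the `ẑ^×`-ambiguity (it is `±1` by integrality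
of the multiplier, `+1` by ampleness).  Kernel COUNTS (`#K = q²`, the line `K ∩ A[𝔭_{c•w}]`) are read by FILE B (★ B1∕B2-loc∕B3a (7c)) at the frame lattices through (Q).
A genuine lemma (size L; frame work).  Dealt BY NAME → LA5-p01 (g3) (author of ★ p849552∕p849751∕p849925).  NOT asserted by declaring it.
(print: Kottwitz1992, §5 p. 390) (print: Milne2005ShimuraVarieties, §6 Thm. 6.11 p. 74, Thm. 13.6 p. 118) (print: Deligne1971TravauxShimura, 4.11–4.12 pp. 148–149)
(print: ShimuraIATAF1971, §3.2) (print: Lange2023AbelianVarietiesComplex, §3.4 Proposition 3.4.1) -/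
def OrganMP : Prop :=
  ∀ (F : Type) [Field F] [NumberField F] [IsCMField F] [IsGalois ℚ F] (ι₁ : F →+* ℂ)
    (Jstar : Matrix (Fin 2) (Fin 2) F) (hJ : (Jstar.map (IsCMField.complexConj F))ᵀ = Jstar) (hJu : IsUnit Jstar)
    (K₀ : C5.OpenCompactSubgroup (GSAdele F Jstar)) (S : RecordSystemGS F Jstar ι₁ K₀) (hU7ₛ : S.HeckeTranslateDefinedOver) (Kc : C5.SmallLevel K₀)
    (Fi : Type) [Field Fi] [NumberField Fi] [Algebra F Fi] [IsGalois F Fi] (τE : Fi →+* ℂ) (hτE : τE.comp (algebraMap F Fi) = ι₁)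
    (Φ : Set (F →+* ℂ)) (hΦ : IsCMTypeThrough ι₁ Φ) (C : AuxChartGS F ι₁ Jstar K₀ S Kc Fi τE Φ)
    (ξ : F) (k : ℕ) (Fr : SymplecticFrameV F (RingHom.id F) Jstar ((k : ℚ) • ξ) C.g C.δ) (_hpin : IsChartOfFrame hΦ C ξ k Fr)
    (ε : (Literature.AlgebraicGeometry.Motives.baseChange F Fi).obj (S.M.obj Kc) ⟶
        (Literature.AlgebraicGeometry.Motives.baseChange ℚ Fi).obj C.𝓜.M)
    (_hε : letI : Algebra Fi ℂ := τE.toAlgebra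
      ∀ (P : ComplexPoints ((Literature.AlgebraicGeometry.Motives.baseChange F Fi).obj (S.M.obj Kc)))
        (Pflat : letI : Algebra F ℂ := ι₁.toAlgebra; ComplexPoints (S.M.obj Kc)),
        Pflat.left = P.left ≫ pullback.fst (S.M.obj Kc).hom (bcSpec F Fi) →
        (AlgPoints.map ε P).left ≫ pullback.fst C.𝓜.M.hom (bcSpec ℚ Fi) =
          (letI : Algebra F ℂ := ι₁.toAlgebra; (C.f (S.pts Kc Pflat)).left))
    (ρ : AbelianSchemeOver.RingAction (𝓞 F) (C.𝓜.univ.baseChange (ε.left ≫ pullback.fst C.𝓜.M.hom (bcSpec ℚ Fi))).A),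
    RingActionReading C ε ρ →
    ∀ (N' : C5.SmallLevel K₀) (hN'Kc : N' ≤ Kc) (x' : letI : Algebra F ℂ := ι₁.toAlgebra; AlgPoints (S.M.obj N') ℂ),
      letI : Algebra F ℂ := ι₁.toAlgebra
      letI : Algebra Fi ℂ := τE.toAlgebra
      letI P := C.𝓜.univ.baseChange (ε.left ≫ pullback.fst C.𝓜.M.hom (bcSpec ℚ Fi))
      letI y₁ := AlgPoints.map (S.M.map (homOfLE hN'Kc)) x'
      letI x₁ := sheetPt ι₁ τE hτE S Kc y₁
      -- STAGE A (depends on `x′` only): the frame class of `x′`, ONE reading of `y₁ = ℓ x′` and its class mover `q₁`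
      ∃ (v : Fin 2 → ℂ) (hv : v ∈ negCone (Jstar.map ι₁)) (a' : GSAdele F Jstar)
        (v₁ : Fin 2 → ℂ) (hv₁ : v₁ ∈ negCone (Jstar.map ι₁)) (a₁ : GSAdele F Jstar) (q₁ : ↥(gspRational C.δ))
        (m₁ : SiegelAdelicMarking ⟨SiegelModuli.jOfSiegel C.δ (C.Z a₁ v₁),
            SiegelComplexRecordSystem.jOfSiegel_mem_C0pm C.hδ.1 (C.Z_mem a₁ v₁ hv₁)⟩ (C.rep (C.piece a₁)) (P.A.fibre x₁.left).toAbelianVariety)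
        (Θ₁ : Literature.AlgebraicGeometry.Motives.CartierDivisor (P.A.fibre x₁.left).toAbelianVariety.X.left)
        (Λ₁ : P.level.SymplecticLift x₁.left Θ₁ C.δ),
        -- (F₁) THE FRAME CLASS of `x′` and the READING CLASS of `y₁ = ℓ x′`
        S.pts N' x' = ShimuraSetGS.mk F Jstar ι₁ N'.1.1 v hv a' ∧
        S.pts Kc y₁ = ShimuraSetGS.mk F Jstar ι₁ Kc.1.1 v₁ hv₁ a₁ ∧
        -- (Q₁) THE CLASS MOVER `q₁`: `[v₁, a₁] = [v, a′]` (★ `exists_mover_of_mk_eq_mk_frame` shape)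
        (conjJ (((gspRationalToReal C.δ q₁)⁻¹ : ↥(gspReal C.δ)) : GL (Fin C.g ⊕ Fin C.g) ℝ) (C.J v) = SiegelModuli.jOfSiegel C.δ (C.Z a₁ v₁) ∧
          gspRationalToFinAdelic C.δ q₁ • ((C.rep (C.piece a₁) : ↥(gspFinAdelic C.δ)) : ↥(gspFinAdelic C.δ) ⧸ principalLevelSubgroup C.δ C.N) =
            ((C.b a' : ↥(gspFinAdelic C.δ)) : ↥(gspFinAdelic C.δ) ⧸ principalLevelSubgroup C.δ C.N) ∧
          ∀ b : 𝓞 F, (C.Mρ a₁ b).map (Int.cast : ℤ → ℚ) =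
            (((q₁⁻¹ : ↥(gspRational C.δ)) : GL (Fin C.g ⊕ Fin C.g) ℚ) : Matrix (Fin C.g ⊕ Fin C.g) (Fin C.g ⊕ Fin C.g) ℚ) *
              (C.ρ₀ b).map (Int.cast : ℤ → ℚ) *
              (((q₁ : ↥(gspRational C.δ)) : GL (Fin C.g ⊕ Fin C.g) ℚ) : Matrix (Fin C.g ⊕ Fin C.g) (Fin C.g ⊕ Fin C.g) ℚ)) ∧
        -- (R₁) THE READING AT `y₁` (L6 `Reads` clause at the chart՚s principal representative `(C.u (piece a₁), C.rep (piece a₁))`)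
        (Θ₁.IsAmple ∧ P.A.IsLambdaOfAt x₁.left P.D P.pol.lam Θ₁ ∧
          (∀ ⦃M : ℕ⦄, C.N ∣ M → M ≠ 0 → ∀ (y' : Fin C.g ⊕ Fin C.g → ZMod M) (w : Fin C.g ⊕ Fin C.g → ℚ),
            AdelicCongr (((C.rep (C.piece a₁))⁻¹ : ↥(gspFinAdelic C.δ)) : GL (Fin C.g ⊕ Fin C.g) finAdeleQ) 1 w (fun i => ((y' i).val : ℚ) / M) →
              ((Λ₁.lift M (Multiplicative.ofAdd y')) : (P.A.fibre x₁.left).toAbelianVariety.Points ℂ) = m₁.r w) ∧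
          m₁.γ = 1 ∧ (∀ u : Fin C.g ⊕ Fin C.g → ℝ, m₁.Ψ u = siegelPeriodMap C.δ (C.Z a₁ v₁) u) ∧
          ∀ (b : 𝓞 F) (s : ComplexTorus m₁.Ψ),
            haveI := ρ.isMonHom b
            AlgPoints.map (AbelianSchemeOver.fibreHom (ρ.i b) x₁.left).hom.hom.hom (m₁.toFun s) =
              m₁.toFun (ComplexTorus.mapMatrix m₁.Ψ m₁.Ψ (C.Mρ a₁ b) s)) ∧
        -- (MP-J₁) the action reading is `ℂ`-LINEAR for `J(Z a₁ v₁)` ((M) `C.Mρ_kottwitz`; (O-HF) `hMJ`)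
        (∀ b : 𝓞 F, (C.Mρ a₁ b).map (Int.cast : ℤ → ℝ) * SiegelModuli.jOfSiegel C.δ (C.Z a₁ v₁) =
            SiegelModuli.jOfSiegel C.δ (C.Z a₁ v₁) * (C.Mρ a₁ b).map (Int.cast : ℤ → ℝ)) ∧
        -- STAGE B (for every split place `w` with `Kc` hyperspecial at `v` and `J⋆_w ∈ GL₂(𝒪_w)`, and every Hecke representative `t` of a coset in `Kc t_{w,i} Kc ∕ Kc`)
        ∀ (w : HeightOneSpectrum (𝓞 F)) (hw : (IsCMField.complexConj F) • w ≠ w),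
          UnitaryGroup.IsHyperspecialAt ↥(maximalRealSubfield F) F (IsCMField.complexConj F) 2 Jstar Kc.1.1
              (w.under (𝓞 ↥(maximalRealSubfield F))) →
          (UnitaryGroup.isUnit_placeForm Jstar hJu w).unit ∈ glInt 2 (w.adicCompletion F) →
          ∀ (i : ℕ) (t : GSAdele F Jstar)
            (_ht : ((t : ↥(finAdelic ↥(maximalRealSubfield F) F (IsCMField.complexConj F) 2 Jstar)) :
                ↥(finAdelic ↥(maximalRealSubfield F) F (IsCMField.complexConj F) 2 Jstar) ⧸
                  (Kc.1.1 : Subgroup ↥(finAdelic ↥(maximalRealSubfield F) F (IsCMField.complexConj F) 2 Jstar))) ∈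
              orbit (Kc.1.1 : Subgroup ↥(finAdelic ↥(maximalRealSubfield F) F (IsCMField.complexConj F) 2 Jstar))
                ((UnitaryGroup.heckeElementAt ↥(maximalRealSubfield F) F (IsCMField.complexConj F) 2 Jstar
                    (⟨w, rfl⟩ : UnitaryGroup.PlacesOver F (w.under (𝓞 ↥(maximalRealSubfield F))))
                    (IsCMField.complexConj_ne_one F) hJ hw (UnitaryGroup.isUnit_placeForm Jstar hJu w) (HeckeCharacter.uniformizer F w) i :
                  ↥(finAdelic ↥(maximalRealSubfield F) F (IsCMField.complexConj F) 2 Jstar)) :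
                  ↥(finAdelic ↥(maximalRealSubfield F) F (IsCMField.complexConj F) 2 Jstar) ⧸
                    (Kc.1.1 : Subgroup ↥(finAdelic ↥(maximalRealSubfield F) F (IsCMField.complexConj F) 2 Jstar))))
            (htN : C5.HeckeLE t N' Kc),
            letI y₂ := AlgPoints.map (recordHeckeTranslateGS S hU7ₛ t N' Kc htN) x'
            letI x₂ := sheetPt ι₁ τE hτE S Kc y₂
            ∃ (v₂ : Fin 2 → ℂ) (hv₂ : v₂ ∈ negCone (Jstar.map ι₁)) (a₂ : GSAdele F Jstar) (q₂ : ↥(gspRational C.δ))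
              (m₂ : SiegelAdelicMarking ⟨SiegelModuli.jOfSiegel C.δ (C.Z a₂ v₂),
                  SiegelComplexRecordSystem.jOfSiegel_mem_C0pm C.hδ.1 (C.Z_mem a₂ v₂ hv₂)⟩ (C.rep (C.piece a₂)) (P.A.fibre x₂.left).toAbelianVariety)
              (Θ₂ : Literature.AlgebraicGeometry.Motives.CartierDivisor (P.A.fibre x₂.left).toAbelianVariety.X.left)
              (Λ₂ : P.level.SymplecticLift x₂.left Θ₂ C.δ),
              -- (F₂) THE READING CLASS of `y₂ = T_t x′` (`= [v, a′ t]`)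
              S.pts Kc y₂ = ShimuraSetGS.mk F Jstar ι₁ Kc.1.1 v₂ hv₂ a₂ ∧
              -- (Q₂) THE CLASS MOVER `q₂`: `[v₂, a₂] = [v, a′ t]`
              (conjJ (((gspRationalToReal C.δ q₂)⁻¹ : ↥(gspReal C.δ)) : GL (Fin C.g ⊕ Fin C.g) ℝ) (C.J v) = SiegelModuli.jOfSiegel C.δ (C.Z a₂ v₂) ∧
                gspRationalToFinAdelic C.δ q₂ • ((C.rep (C.piece a₂) : ↥(gspFinAdelic C.δ)) : ↥(gspFinAdelic C.δ) ⧸ principalLevelSubgroup C.δ C.N) =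
                  ((C.b (a' * t) : ↥(gspFinAdelic C.δ)) : ↥(gspFinAdelic C.δ) ⧸ principalLevelSubgroup C.δ C.N) ∧
                ∀ b : 𝓞 F, (C.Mρ a₂ b).map (Int.cast : ℤ → ℚ) =
                  (((q₂⁻¹ : ↥(gspRational C.δ)) : GL (Fin C.g ⊕ Fin C.g) ℚ) : Matrix (Fin C.g ⊕ Fin C.g) (Fin C.g ⊕ Fin C.g) ℚ) *
                    (C.ρ₀ b).map (Int.cast : ℤ → ℚ) *
                    (((q₂ : ↥(gspRational C.δ)) : GL (Fin C.g ⊕ Fin C.g) ℚ) : Matrix (Fin C.g ⊕ Fin C.g) (Fin C.g ⊕ Fin C.g) ℚ)) ∧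
              -- (R₂) THE READING AT `y₂`
              (Θ₂.IsAmple ∧ P.A.IsLambdaOfAt x₂.left P.D P.pol.lam Θ₂ ∧
                (∀ ⦃M : ℕ⦄, C.N ∣ M → M ≠ 0 → ∀ (y' : Fin C.g ⊕ Fin C.g → ZMod M) (w : Fin C.g ⊕ Fin C.g → ℚ),
                  AdelicCongr (((C.rep (C.piece a₂))⁻¹ : ↥(gspFinAdelic C.δ)) : GL (Fin C.g ⊕ Fin C.g) finAdeleQ) 1 w (fun i => ((y' i).val : ℚ) / M) →
                    ((Λ₂.lift M (Multiplicative.ofAdd y')) : (P.A.fibre x₂.left).toAbelianVariety.Points ℂ) = m₂.r w) ∧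
                m₂.γ = 1 ∧ (∀ u : Fin C.g ⊕ Fin C.g → ℝ, m₂.Ψ u = siegelPeriodMap C.δ (C.Z a₂ v₂) u) ∧
                ∀ (b : 𝓞 F) (s : ComplexTorus m₂.Ψ),
                  haveI := ρ.isMonHom b
                  AlgPoints.map (AbelianSchemeOver.fibreHom (ρ.i b) x₂.left).hom.hom.hom (m₂.toFun s) =
                    m₂.toFun (ComplexTorus.mapMatrix m₂.Ψ m₂.Ψ (C.Mρ a₂ b) s)) ∧
              -- (MP-J₂)
              (∀ b : 𝓞 F, (C.Mρ a₂ b).map (Int.cast : ℤ → ℝ) * SiegelModuli.jOfSiegel C.δ (C.Z a₂ v₂) =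
                  SiegelModuli.jOfSiegel C.δ (C.Z a₂ v₂) * (C.Mρ a₂ b).map (Int.cast : ℤ → ℝ)) ∧
              -- (T) THE RATIONAL TRANSPORTER `T := q₂⁻¹ q₁`
              letI T : Matrix (Fin C.g ⊕ Fin C.g) (Fin C.g ⊕ Fin C.g) ℚ :=
                (((q₂⁻¹ * q₁ : ↥(gspRational C.δ)) : GL (Fin C.g ⊕ Fin C.g) ℚ) : Matrix (Fin C.g ⊕ Fin C.g) (Fin C.g ⊕ Fin C.g) ℚ)
              -- (T-J) `T` carries the complex structure of `y₁` to that of `y₂` ((O-HF) `hTJ`)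
              T.map (algebraMap ℚ ℝ) * SiegelModuli.jOfSiegel C.δ (C.Z a₁ v₁) = SiegelModuli.jOfSiegel C.δ (C.Z a₂ v₂) * T.map (algebraMap ℚ ℝ) ∧
              -- (T-ρ) `T` intertwines the two integral readings ((O-HF) `hTM`)
              (∀ b : 𝓞 F, T * (C.Mρ a₁ b).map (Int.cast : ℤ → ℚ) = (C.Mρ a₂ b).map (Int.cast : ℤ → ℚ) * T) ∧
              -- (T-ν) `T` is `ψ_δ`-symplectic (multiplier `1`; (ρ-SIM) `ν = p²` at `π = p`)
              Tᵀ * (typeForm C.δ).map (Int.cast : ℤ → ℚ) * T = (typeForm C.δ).map (Int.cast : ℤ → ℚ) ∧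
              -- (T-Λ) the `𝔭_w`-family `T · Mρ a₁(π)` moves `Λ(rep (piece a₁))` into `Λ(rep (piece a₂))` ((O-HF) `hΛ`)
              (∀ π ∈ w.asIdeal, ∀ z ∈ Literature.NumberTheory.Adeles.latticeOfGL
                  ((C.rep (C.piece a₁) : ↥(gspFinAdelic C.δ)) : GL (Fin C.g ⊕ Fin C.g) finAdeleQ),
                (T * (C.Mρ a₁ π).map (Int.cast : ℤ → ℚ)) *ᵥ z ∈ Literature.NumberTheory.Adeles.latticeOfGL
                  ((C.rep (C.piece a₂) : ↥(gspFinAdelic C.δ)) : GL (Fin C.g ⊕ Fin C.g) finAdeleQ)) ∧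
              -- (T-Λ♭) conversely `ρ(𝔭_{c•w})·T⁻¹Λ(rep (piece a₂)) ⊆ Λ(rep (piece a₁))` (every `i`; ★ (L-b) transported = ★ p850267 `transporter_mulVec_mem_imp_reading_mulVec_mem_latticeOfGL`;
              -- (O-R1): with (T-Λ), `N_β := T_β⁻¹Λ₂^β` is a `𝔭_w`-NEIGHBOUR `ρ(𝔭_w)Λ₁ ⊆ N_β`, `ρ(𝔭_{c•w})N_β ⊆ Λ₁`, so `H_β = (N_β + Λ₁)∕Λ₁ ⊆ A_{y₁}[𝔭_{c•w}]`; LA5-p01 (g3) 07:40:56Z «=»)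
              (∀ a ∈ ((IsCMField.complexConj F) • w).asIdeal, ∀ z : Fin C.g ⊕ Fin C.g → ℚ,
                T *ᵥ z ∈ Literature.NumberTheory.Adeles.latticeOfGL ((C.rep (C.piece a₂) : ↥(gspFinAdelic C.δ)) : GL (Fin C.g ⊕ Fin C.g) finAdeleQ) →
                ((C.Mρ a₁ a).map (Int.cast : ℤ → ℚ)) *ᵥ z ∈ Literature.NumberTheory.Adeles.latticeOfGL
                  ((C.rep (C.piece a₁) : ↥(gspFinAdelic C.δ)) : GL (Fin C.g ⊕ Fin C.g) finAdeleQ)) ∧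
              -- (T-Λc) THE CENTRAL KERNEL LAW, for the CENTRAL operator only (`i = 2`, `t ∈ Kc·t_{w,2}·Kc`): `𝔭_w⁻¹·T⁻¹Λ(rep (piece a₂)) = 𝔭_{c•w}⁻¹·Λ(rep (piece a₁))`,
              -- i.e. `K₂ = A_{y₁}[𝔭_{c•w}]` — the `hK₂` half of `HeckeCentralRoofsAt` ((O-R2) census A-p06 (g35) 07:31:25Z; (T-Λ) gives only `ρ(𝔭_w)Λ₁ ⊆ T⁻¹Λ₂`).
              -- Locally at `v = w·w̄`: `(t_{w,2})_v = (ϖ·1 at w, ϖ̄⁻¹·1 at w̄)` (unitarity), so `T⁻¹Λ₂ = 𝔭_w𝔭_{c•w}⁻¹Λ₁`.  PAYMENT L5-#13: (L-d =) frame ★ (LA5-p02) → transport (LA5-p01, pattern of ★ p850154).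
              (i = 2 → ∀ z : Fin C.g ⊕ Fin C.g → ℚ,
                (∀ π ∈ w.asIdeal, (T * (C.Mρ a₁ π).map (Int.cast : ℤ → ℚ)) *ᵥ z ∈ Literature.NumberTheory.Adeles.latticeOfGL
                    ((C.rep (C.piece a₂) : ↥(gspFinAdelic C.δ)) : GL (Fin C.g ⊕ Fin C.g) finAdeleQ)) ↔
                (∀ a ∈ ((IsCMField.complexConj F) • w).asIdeal, ((C.Mρ a₁ a).map (Int.cast : ℤ → ℚ)) *ᵥ z ∈ Literature.NumberTheory.Adeles.latticeOfGL
                    ((C.rep (C.piece a₁) : ↥(gspFinAdelic C.δ)) : GL (Fin C.g ⊕ Fin C.g) finAdeleQ))) ∧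
              -- (T-lvl) it carries level vectors of `y₁` to level vectors of `y₂` modulo `Λ(rep (piece a₂))` (roof law `hlvl`) — GUARDED (v7, B-p08 (g35) census #2 07:55:06Z road (α)):
              -- at the residue characteristic `p` of `w` with `p ∤ C.N` (the consumers `OrganER1`∕`OrganER2` hold `Nat.Prime pChar`, `(pChar : 𝓞 F) ∈ w.asIdeal`, `¬ pChar ∣ C.N` as binders;
              -- ★ p850257 `transporter_level_sub_mem_latticeOfGL` takes exactly `(hp : p.Prime) (hpw : (p : 𝓞 F) ∈ w.asIdeal) (hpN : ¬ p ∣ N)` — at `p ∣ N` the `v`-component of `t` moves level vectors)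
              (∀ p : ℕ, Nat.Prime p → (p : 𝓞 F) ∈ w.asIdeal → ¬ p ∣ C.N → ∀ (y' : Fin C.g ⊕ Fin C.g → ZMod C.N) (w₁ w₂ : Fin C.g ⊕ Fin C.g → ℚ),
                AdelicCongr (((C.rep (C.piece a₁))⁻¹ : ↥(gspFinAdelic C.δ)) : GL (Fin C.g ⊕ Fin C.g) finAdeleQ) 1 w₁ (fun i => ((y' i).val : ℚ) / C.N) →
                AdelicCongr (((C.rep (C.piece a₂))⁻¹ : ↥(gspFinAdelic C.δ)) : GL (Fin C.g ⊕ Fin C.g) finAdeleQ) 1 w₂ (fun i => ((y' i).val : ℚ) / C.N) →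
                ∀ π ∈ w.asIdeal,
                  (T * (C.Mρ a₁ π).map (Int.cast : ℤ → ℚ)) *ᵥ w₁ - ((C.Mρ a₂ π).map (Int.cast : ℤ → ℚ)) *ᵥ w₂ ∈
                    Literature.NumberTheory.Adeles.latticeOfGL ((C.rep (C.piece a₂) : ↥(gspFinAdelic C.δ)) : GL (Fin C.g ⊕ Fin C.g) finAdeleQ))

set_option maxHeartbeats 400000 in
/-- **(O-MP) STAGE A, PROVED** — the `x′`-only half of `OrganMP`: the frame class `[v, a′]_{N′}` of `x′` (★ `ShimuraSetGS.mk_surjective`), ONE L6 reading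
`(m₁, Θ₁, Λ₁)` of `A_{y₁}`, `y₁ = ℓ x′`, at the chart՚s principal pair (`reads_sheetPt` + `C.rep_spec`), its class mover `q₁` (★ `exists_mover_of_mk_eq_mk_frame`
from `[v₁, a₁]_{Kc} = [v, a′]_{Kc}` = `pts_map_homOfLE`), and the `ℂ`-linearity of the action reading (★ `map_intCast_mul_eq_mul_map_intCast_of_forall_map_r_eq` ∘
★ `map_r_eq_of_map_toFun_mapMatrix`).  The STAGE B hand starts `obtain ⟨…⟩ := organMP_stageA …`. (LA5-plan (g3) pen, v6.)
[cite: Milne2005ShimuraVarieties, §5 Lemma 5.13 p. 57 and §6 Thm. 6.11 p. 74] [cite: Kottwitz1992, §5 (p. 390)] -/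
theorem organMP_stageA :
  ∀ (F : Type) [Field F] [NumberField F] [IsCMField F] [IsGalois ℚ F] (ι₁ : F →+* ℂ)
    (Jstar : Matrix (Fin 2) (Fin 2) F) (hJ : (Jstar.map (IsCMField.complexConj F))ᵀ = Jstar) (hJu : IsUnit Jstar)
    (K₀ : C5.OpenCompactSubgroup (GSAdele F Jstar)) (S : RecordSystemGS F Jstar ι₁ K₀) (hU7ₛ : S.HeckeTranslateDefinedOver) (Kc : C5.SmallLevel K₀)
    (Fi : Type) [Field Fi] [NumberField Fi] [Algebra F Fi] [IsGalois F Fi] (τE : Fi →+* ℂ) (hτE : τE.comp (algebraMap F Fi) = ι₁)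
    (Φ : Set (F →+* ℂ)) (hΦ : IsCMTypeThrough ι₁ Φ) (C : AuxChartGS F ι₁ Jstar K₀ S Kc Fi τE Φ)
    (ξ : F) (k : ℕ) (Fr : SymplecticFrameV F (RingHom.id F) Jstar ((k : ℚ) • ξ) C.g C.δ) (_hpin : IsChartOfFrame hΦ C ξ k Fr)
    (ε : (Literature.AlgebraicGeometry.Motives.baseChange F Fi).obj (S.M.obj Kc) ⟶
        (Literature.AlgebraicGeometry.Motives.baseChange ℚ Fi).obj C.𝓜.M)
    (_hε : letI : Algebra Fi ℂ := τE.toAlgebra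
      ∀ (P : ComplexPoints ((Literature.AlgebraicGeometry.Motives.baseChange F Fi).obj (S.M.obj Kc)))
        (Pflat : letI : Algebra F ℂ := ι₁.toAlgebra; ComplexPoints (S.M.obj Kc)),
        Pflat.left = P.left ≫ pullback.fst (S.M.obj Kc).hom (bcSpec F Fi) →
        (AlgPoints.map ε P).left ≫ pullback.fst C.𝓜.M.hom (bcSpec ℚ Fi) =
          (letI : Algebra F ℂ := ι₁.toAlgebra; (C.f (S.pts Kc Pflat)).left))
    (ρ : AbelianSchemeOver.RingAction (𝓞 F) (C.𝓜.univ.baseChange (ε.left ≫ pullback.fst C.𝓜.M.hom (bcSpec ℚ Fi))).A),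
    RingActionReading C ε ρ →
    ∀ (N' : C5.SmallLevel K₀) (hN'Kc : N' ≤ Kc) (x' : letI : Algebra F ℂ := ι₁.toAlgebra; AlgPoints (S.M.obj N') ℂ),
      letI : Algebra F ℂ := ι₁.toAlgebra
      letI : Algebra Fi ℂ := τE.toAlgebra
      letI P := C.𝓜.univ.baseChange (ε.left ≫ pullback.fst C.𝓜.M.hom (bcSpec ℚ Fi))
      letI y₁ := AlgPoints.map (S.M.map (homOfLE hN'Kc)) x'
      letI x₁ := sheetPt ι₁ τE hτE S Kc y₁
      -- STAGE A (depends on `x′` only): the frame class of `x′`, ONE reading of `y₁ = ℓ x′` and its class mover `q₁`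
      ∃ (v : Fin 2 → ℂ) (hv : v ∈ negCone (Jstar.map ι₁)) (a' : GSAdele F Jstar)
        (v₁ : Fin 2 → ℂ) (hv₁ : v₁ ∈ negCone (Jstar.map ι₁)) (a₁ : GSAdele F Jstar) (q₁ : ↥(gspRational C.δ))
        (m₁ : SiegelAdelicMarking ⟨SiegelModuli.jOfSiegel C.δ (C.Z a₁ v₁),
            SiegelComplexRecordSystem.jOfSiegel_mem_C0pm C.hδ.1 (C.Z_mem a₁ v₁ hv₁)⟩ (C.rep (C.piece a₁)) (P.A.fibre x₁.left).toAbelianVariety)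
        (Θ₁ : Literature.AlgebraicGeometry.Motives.CartierDivisor (P.A.fibre x₁.left).toAbelianVariety.X.left)
        (Λ₁ : P.level.SymplecticLift x₁.left Θ₁ C.δ),
        -- (F₁) THE FRAME CLASS of `x′` and the READING CLASS of `y₁ = ℓ x′`
        S.pts N' x' = ShimuraSetGS.mk F Jstar ι₁ N'.1.1 v hv a' ∧
        S.pts Kc y₁ = ShimuraSetGS.mk F Jstar ι₁ Kc.1.1 v₁ hv₁ a₁ ∧
        -- (Q₁) THE CLASS MOVER `q₁`: `[v₁, a₁] = [v, a′]` (★ `exists_mover_of_mk_eq_mk_frame` shape)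
        (conjJ (((gspRationalToReal C.δ q₁)⁻¹ : ↥(gspReal C.δ)) : GL (Fin C.g ⊕ Fin C.g) ℝ) (C.J v) = SiegelModuli.jOfSiegel C.δ (C.Z a₁ v₁) ∧
          gspRationalToFinAdelic C.δ q₁ • ((C.rep (C.piece a₁) : ↥(gspFinAdelic C.δ)) : ↥(gspFinAdelic C.δ) ⧸ principalLevelSubgroup C.δ C.N) =
            ((C.b a' : ↥(gspFinAdelic C.δ)) : ↥(gspFinAdelic C.δ) ⧸ principalLevelSubgroup C.δ C.N) ∧
          ∀ b : 𝓞 F, (C.Mρ a₁ b).map (Int.cast : ℤ → ℚ) =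
            (((q₁⁻¹ : ↥(gspRational C.δ)) : GL (Fin C.g ⊕ Fin C.g) ℚ) : Matrix (Fin C.g ⊕ Fin C.g) (Fin C.g ⊕ Fin C.g) ℚ) *
              (C.ρ₀ b).map (Int.cast : ℤ → ℚ) *
              (((q₁ : ↥(gspRational C.δ)) : GL (Fin C.g ⊕ Fin C.g) ℚ) : Matrix (Fin C.g ⊕ Fin C.g) (Fin C.g ⊕ Fin C.g) ℚ)) ∧
        -- (R₁) THE READING AT `y₁` (L6 `Reads` clause at the chart՚s principal representative `(C.u (piece a₁), C.rep (piece a₁))`)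
        (Θ₁.IsAmple ∧ P.A.IsLambdaOfAt x₁.left P.D P.pol.lam Θ₁ ∧
          (∀ ⦃M : ℕ⦄, C.N ∣ M → M ≠ 0 → ∀ (y' : Fin C.g ⊕ Fin C.g → ZMod M) (w : Fin C.g ⊕ Fin C.g → ℚ),
            AdelicCongr (((C.rep (C.piece a₁))⁻¹ : ↥(gspFinAdelic C.δ)) : GL (Fin C.g ⊕ Fin C.g) finAdeleQ) 1 w (fun i => ((y' i).val : ℚ) / M) →
              ((Λ₁.lift M (Multiplicative.ofAdd y')) : (P.A.fibre x₁.left).toAbelianVariety.Points ℂ) = m₁.r w) ∧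
          m₁.γ = 1 ∧ (∀ u : Fin C.g ⊕ Fin C.g → ℝ, m₁.Ψ u = siegelPeriodMap C.δ (C.Z a₁ v₁) u) ∧
          ∀ (b : 𝓞 F) (s : ComplexTorus m₁.Ψ),
            haveI := ρ.isMonHom b
            AlgPoints.map (AbelianSchemeOver.fibreHom (ρ.i b) x₁.left).hom.hom.hom (m₁.toFun s) =
              m₁.toFun (ComplexTorus.mapMatrix m₁.Ψ m₁.Ψ (C.Mρ a₁ b) s)) ∧
        -- (MP-J₁) the action reading is `ℂ`-LINEAR for `J(Z a₁ v₁)` ((M) `C.Mρ_kottwitz`; (O-HF) `hMJ`)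
        (∀ b : 𝓞 F, (C.Mρ a₁ b).map (Int.cast : ℤ → ℝ) * SiegelModuli.jOfSiegel C.δ (C.Z a₁ v₁) =
            SiegelModuli.jOfSiegel C.δ (C.Z a₁ v₁) * (C.Mρ a₁ b).map (Int.cast : ℤ → ℝ))
    := by
  intro F _ _ _ _ ι₁ Jstar hJ hJu K₀ S hU7ₛ Kc Fi _ _ _ _ τE hτE Φ hΦ C ξ k Fr _hpin ε _hε ρ hR N' hN'Kc x'
  letI : Algebra F ℂ := ι₁.toAlgebra
  letI : Algebra Fi ℂ := τE.toAlgebra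
  -- (n3 cure, A-p04 (g23) in `F0P6aStubE6.exists_markedReading_of_reads`): every existential is opened with `Exists.elim` ∕ projections —
  -- `rcases`∕`obtain` on these `letI`-laden goals is the heartbeat hog (v6-WIP check 1: whnf timeout at 400000).
  -- (F₁, first half) the frame class of `x′`
  refine (ShimuraSetGS.mk_surjective F Jstar ι₁ N'.1.1 (S.pts N' x')).elim fun v h => h.elim fun hv h => h.elim fun a' hx' => ?_
  -- (R₁) the L6 reading at `y₁ = ℓ x′`, at the chart՚s principal pair `(C.u (piece a₁), C.rep (piece a₁))`
  refine (reads_sheetPt ι₁ τE hτE C ε ρ hR (AlgPoints.map (S.M.map (homOfLE hN'Kc)) x')).elim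
    fun v₁ h => h.elim fun hv₁ h => h.elim fun a₁ hva => ?_
  have hy₁ := hva.1
  have hsp := C.rep_spec (C.piece a₁)
  refine (hva.2 (C.u (C.piece a₁)) (C.rep (C.piece a₁)) hsp.1 hsp.2.1 hsp.2.2.1 hsp.2.2.2.1 hsp.2.2.2.2).elim
    fun m₁ h => h.elim fun Θ₁ h => h.elim fun Λ₁ hΛ => ?_
  have hamp := hΛ.1
  have hlam := hΛ.2.1
  have htower := hΛ.2.2.1
  have hγ := hΛ.2.2.2.1
  have hΨ := hΛ.2.2.2.2.1
  have hact := hΛ.2.2.2.2.2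
  -- (Q₁) the class mover: `[v₁, a₁]_{Kc} = [v, a′]_{Kc}` (★ `exists_mover_of_mk_eq_mk_frame`, argument list of `F0P6aSigmaGAL.kcm_chain_of_cm_recip`)
  have hcl : ShimuraSetGS.mk F Jstar ι₁ Kc.1.1 v₁ hv₁ a₁ = ShimuraSetGS.mk F Jstar ι₁ Kc.1.1 v hv a' :=
    hy₁.symm.trans (pts_map_homOfLE ι₁ S N' Kc hN'Kc x' v hv a' hx'.symm)
  refine (exists_mover_of_mk_eq_mk_frame C.J C.hJsmul C.b C.bq C.hb C.hJrat Kc.1.1 C.hle C.piece C.Z C.rep C.q C.q_spec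
      (fun b' : 𝓞 F => C.ρ₀ b') (fun a'' (b' : 𝓞 F) => C.Mρ a'' b') C.Mρ_frame C.bq_comm_ρ₀ v₁ hv₁ a₁ v hv a' hcl).elim fun q₁ hq => ?_
  -- (MP-J₁) the action reading is `ℂ`-linear (★ p850115 + ★ `map_r_eq_of_map_toFun_mapMatrix`)
  have hMJ : ∀ b : 𝓞 F, (C.Mρ a₁ b).map (Int.cast : ℤ → ℝ) * SiegelModuli.jOfSiegel C.δ (C.Z a₁ v₁) =
      SiegelModuli.jOfSiegel C.δ (C.Z a₁ v₁) * (C.Mρ a₁ b).map (Int.cast : ℤ → ℝ) := fun b => by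
    haveI := ρ.isMonHom b
    exact SiegelAdelicMarking.map_intCast_mul_eq_mul_map_intCast_of_forall_map_r_eq m₁ m₁ _ (C.Mρ a₁ b)
      (fun u => SiegelAdelicMarking.map_r_eq_of_map_toFun_mapMatrix m₁ hγ _ (C.Mρ a₁ b) (hact b) u)
  exact ⟨v, hv, a', v₁, hv₁, a₁, q₁, m₁, Θ₁, Λ₁, hx'.symm, hy₁, hq, ⟨hamp, hlam, htower, hγ, hΨ, hact⟩, hMJ⟩

/-! #### (O-MP) STAGE B — B-p08 (g35), L5-#11′ (LA5-plan (g3) 07:44:51Z ∕ 08:02:06Z).  Add-only: two frame-free transporter identities (T-J)(T-ρ) and the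
`stub_MP` BODY = STAGE A (`organMP_stageA`, opened with `Exists.elim` + projections — the n3-cure) + the per-`(w, i, t)` junction: the `y₂`-reading
(`reads_sheetPt` + `C.rep_spec`), the mover `q₂` (★ `exists_mover_of_mk_eq_mk_frame` at `pts_map_recordHeckeTranslateGS`), (MP-J₂) (★ p850115), the PIN
(`C.b = ũ_{Fr}(·,1)`, `(C.ρ₀ b)_ℚ = P·res(b•1)·Q`), the twist data OF the pinned frame (★ p850335 `exists_twist_of_frame` from `C.hle`), then (T-ν)(T-Λ)(T-Λ♭)(T-Λc)(T-lvl)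
BY NAME (★ p850154 ∕ p850267 ∕ p850301 + ★ p850382 `hframe` ∕ p850257). -/

/-- **(T-J), frame-free**: if the movers `q₁, q₂ ∈ GSp_δ(ℚ)` carry ONE complex structure `J₀` to `J₁`, `J₂` (`conjJ (qᵢ)_ℝ⁻¹ J₀ = Jᵢ`), then the rational
transporter `T := q₂⁻¹q₁` intertwines them: `T_ℝ J₁ = J₂ T_ℝ` (`T_ℝ = (q₂)_ℝ⁻¹(q₁)_ℝ`, `Jᵢ = (qᵢ)_ℝ⁻¹ J₀ (qᵢ)_ℝ`). [cite: Milne2005ShimuraVarieties, §6 pp. 67–70] -/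
theorem transporter_map_real_mul_eq_mul_of_conjJ {g : ℕ} {δ : Fin g → ℕ} (q₁ q₂ : ↥(gspRational δ))
    (J₀ J₁ J₂ : Matrix (Fin g ⊕ Fin g) (Fin g ⊕ Fin g) ℝ)
    (hJ₁ : conjJ (((gspRationalToReal δ q₁)⁻¹ : ↥(gspReal δ)) : GL (Fin g ⊕ Fin g) ℝ) J₀ = J₁)
    (hJ₂ : conjJ (((gspRationalToReal δ q₂)⁻¹ : ↥(gspReal δ)) : GL (Fin g ⊕ Fin g) ℝ) J₀ = J₂) :
    ((((q₂⁻¹ * q₁ : ↥(gspRational δ)) : GL (Fin g ⊕ Fin g) ℚ) : Matrix (Fin g ⊕ Fin g) (Fin g ⊕ Fin g) ℚ)).map (algebraMap ℚ ℝ) * J₁ =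
      J₂ * ((((q₂⁻¹ * q₁ : ↥(gspRational δ)) : GL (Fin g ⊕ Fin g) ℚ) : Matrix (Fin g ⊕ Fin g) (Fin g ⊕ Fin g) ℚ)).map (algebraMap ℚ ℝ) := by
  have hT : ((((q₂⁻¹ * q₁ : ↥(gspRational δ)) : GL (Fin g ⊕ Fin g) ℚ) : Matrix (Fin g ⊕ Fin g) (Fin g ⊕ Fin g) ℚ)).map (algebraMap ℚ ℝ) =
      ((((gspRationalToReal δ q₂ : ↥(gspReal δ)) : GL (Fin g ⊕ Fin g) ℝ)⁻¹ : GL (Fin g ⊕ Fin g) ℝ) : Matrix (Fin g ⊕ Fin g) (Fin g ⊕ Fin g) ℝ) *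
        (((gspRationalToReal δ q₁ : ↥(gspReal δ)) : GL (Fin g ⊕ Fin g) ℝ) : Matrix (Fin g ⊕ Fin g) (Fin g ⊕ Fin g) ℝ) := by
    have h : ((((q₂⁻¹ * q₁ : ↥(gspRational δ)) : GL (Fin g ⊕ Fin g) ℚ) : Matrix (Fin g ⊕ Fin g) (Fin g ⊕ Fin g) ℚ)).map (algebraMap ℚ ℝ) =
        (((gspRationalToReal δ (q₂⁻¹ * q₁) : ↥(gspReal δ)) : GL (Fin g ⊕ Fin g) ℝ) : Matrix (Fin g ⊕ Fin g) (Fin g ⊕ Fin g) ℝ) := rfl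
    rw [h, map_mul, map_inv, Subgroup.coe_mul, Subgroup.coe_inv, Units.val_mul]
  rw [hT, ← hJ₁, ← hJ₂, conjJ_def, conjJ_def, Subgroup.coe_inv, Subgroup.coe_inv, inv_inv, inv_inv]
  simp only [Matrix.mul_assoc, Units.mul_inv_cancel_left]

/-- **(T-ρ), frame-free**: the rational transporter `T := q₂⁻¹q₁` intertwines the two moved readings `Mᵢ = qᵢ⁻¹ R qᵢ` of one matrix `R`: `T M₁ = M₂ T`.
[cite: Milne2005ShimuraVarieties, §6 p. 75] -/
theorem transporter_mul_movedReading_eq_movedReading_mul {g : ℕ} {δ : Fin g → ℕ} (q₁ q₂ : ↥(gspRational δ))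
    (R M₁ M₂ : Matrix (Fin g ⊕ Fin g) (Fin g ⊕ Fin g) ℚ)
    (hM₁ : M₁ = (((q₁⁻¹ : ↥(gspRational δ)) : GL (Fin g ⊕ Fin g) ℚ) : Matrix (Fin g ⊕ Fin g) (Fin g ⊕ Fin g) ℚ) * R *
      (((q₁ : ↥(gspRational δ)) : GL (Fin g ⊕ Fin g) ℚ) : Matrix (Fin g ⊕ Fin g) (Fin g ⊕ Fin g) ℚ))
    (hM₂ : M₂ = (((q₂⁻¹ : ↥(gspRational δ)) : GL (Fin g ⊕ Fin g) ℚ) : Matrix (Fin g ⊕ Fin g) (Fin g ⊕ Fin g) ℚ) * R *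
      (((q₂ : ↥(gspRational δ)) : GL (Fin g ⊕ Fin g) ℚ) : Matrix (Fin g ⊕ Fin g) (Fin g ⊕ Fin g) ℚ)) :
    (((q₂⁻¹ * q₁ : ↥(gspRational δ)) : GL (Fin g ⊕ Fin g) ℚ) : Matrix (Fin g ⊕ Fin g) (Fin g ⊕ Fin g) ℚ) * M₁ =
      M₂ * (((q₂⁻¹ * q₁ : ↥(gspRational δ)) : GL (Fin g ⊕ Fin g) ℚ) : Matrix (Fin g ⊕ Fin g) (Fin g ⊕ Fin g) ℚ) := by
  rw [hM₁, hM₂, Subgroup.coe_mul, Units.val_mul, Subgroup.coe_inv, Subgroup.coe_inv]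
  simp only [Matrix.mul_assoc, Units.mul_inv_cancel_left]

end Summit.HodgeConjecture.HodgeConjecture.Cruxes.HLiu418.F0P6aStubEHECKE
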